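import Mathlib
import HarnessLib
import Summits.AtomisticToContinuum.FouriersLaw.Theses.JunctionLocality
import Summits.AtomisticToContinuum.FouriersLaw.Theses.SpatialCentreManifold

/-!
# `NonBallistic` is the "no ballistic floor" half of the affine resistance law
(stub for crux `JunctionLocality.SuperadditiveResistance`, stmt-AtomisticToContinuum-11748, line
floating-probe-bypass-laplacian, crux-position web; lead c7, 2026-08-17)

Route `SpatialCentreManifold` carries, along the weak-NESS shell of `pinnedChain ω₂ lam β γ`, the two-sided rate
statement `AffineResistanceLaw` (stmt-AtomisticToContinuum-13407):
`∃ r > 0 ∀ family ∀ D ∃ C ∀ N, |R_N − (N−1)·r| ≤ C` with `R_N := (N−1)/D_N`.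
Route `JunctionLocality` asks, over the SAME shell (same uniqueness hypothesis, same steady-state families, same
response coefficients), for `NonBallistic` (stmt-AtomisticToContinuum-9127):
`∀ ε > 0 ∀ N₀ ∃ N ≥ N₀, D_N ≤ ε·(N−1)` (the conductance is not bounded away from `0` at the ballistic scale).

This file records the elementary implication `AffineResistanceLaw → NonBallistic`
(real analysis: `R_N ≥ (N−1)r − C` with `r > 0`, so for `N ≥ ⌈(C + 1/ε)/r⌉₊ + 2` one has `R_N > 1/ε`; either
`D_N ≤ 0 ≤ ε(N−1)` or `D_N > 0` and then `(N−1)/D_N > 1/ε` is `D_N < ε(N−1)`). Standard axioms; no named fact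
is taken.
-/

noncomputable section

open MeasureTheory Filter Topology
open Literature.MathematicalPhysics.KineticTheory.HeatConduction

namespace Summit.AtomisticToContinuum.FouriersLaw.Cruxes.SuperadditiveResistance.CruxPosition

/-- **Real-analysis core.** If the resistances `R_N = (N−1)/D_N` stay within `C` of the affine law `(N−1)·r`
with `r > 0` for all `N`, then for every `ε > 0` and every `N₀` there is `N ≥ N₀` with `D_N ≤ ε·(N−1)`
(take `N := max N₀ (⌈(C + 1/ε)/r⌉₊ + 2)`; then `R_N ≥ (N−1)r − C > 1/ε`, which forces `D_N < ε(N−1)` when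
`D_N > 0`, while `D_N ≤ 0 ≤ ε(N−1)` otherwise). -/
theorem frequentlySmallConductance_of_affine_bounds {D : ℕ → ℝ} {r C : ℝ} (hr : 0 < r)
    (h : ∀ N : ℕ, |((N : ℝ) - 1) / D N - ((N : ℝ) - 1) * r| ≤ C) (ε : ℝ) (hε : 0 < ε) (N₀ : ℕ) :
    ∃ N : ℕ, N₀ ≤ N ∧ D N ≤ ε * ((N : ℝ) - 1) := by
  refine ⟨max N₀ (⌈(C + 1 / ε) / r⌉₊ + 2), le_max_left _ _, ?_⟩
  set N : ℕ := max N₀ (⌈(C + 1 / ε) / r⌉₊ + 2)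
  have hKN : ⌈(C + 1 / ε) / r⌉₊ + 2 ≤ N := le_max_right _ _
  have hceil : (C + 1 / ε) / r ≤ (⌈(C + 1 / ε) / r⌉₊ : ℝ) := Nat.le_ceil _
  have hcast : ((⌈(C + 1 / ε) / r⌉₊ : ℕ) : ℝ) + 2 ≤ (N : ℝ) := by
    exact_mod_cast hKN
  have h1 : (C + 1 / ε) / r + 1 ≤ (N : ℝ) - 1 := by linarith
  have h2 : C + 1 / ε + r ≤ ((N : ℝ) - 1) * r := by
    have h1' := mul_le_mul_of_nonneg_right h1 hr.le
    rwa [add_mul, one_mul, div_mul_cancel₀ _ hr.ne'] at h1'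
  have hN1 : 0 < (N : ℝ) - 1 := by
    have h0 : (0 : ℝ) ≤ ((⌈(C + 1 / ε) / r⌉₊ : ℕ) : ℝ) := Nat.cast_nonneg _
    linarith
  obtain ⟨hl, _⟩ := abs_le.mp (h N)
  have h3 : 1 / ε < ((N : ℝ) - 1) / D N := by linarith
  rcases le_or_gt (D N) 0 with hD | hD
  · exact hD.trans (mul_nonneg hε.le hN1.le)
  · rw [lt_div_iff₀ hD] at h3
    have h4 : D N = ε * (1 / ε * D N) := by field_simp
    rw [h4]
    exact (mul_lt_mul_of_pos_left h3 hε).le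

/-- **`AffineResistanceLaw → NonBallistic`.** Instantiate the affine law (stmt-AtomisticToContinuum-13407) at the
given parameters, uniqueness hypothesis and temperature, feed it the given steady-state family and response
coefficients, and apply `frequentlySmallConductance_of_affine_bounds`. -/
theorem nonBallistic_of_affineResistanceLaw :
    Summit.AtomisticToContinuum.FouriersLaw.Theses.SpatialCentreManifold.AffineResistanceLaw →
      Summit.AtomisticToContinuum.FouriersLaw.Theses.JunctionLocality.NonBallistic := by
  intro h ω₂ lam β γ hω hl hβ hγ hU μ hμ T hT D hD ε hε N₀
  obtain ⟨r, hr, hfam⟩ := h ω₂ lam β γ hω hl hβ hγ hU T hT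
  obtain ⟨C, hC⟩ := hfam μ hμ D hD
  exact frequentlySmallConductance_of_affine_bounds hr hC ε hε N₀

end Summit.AtomisticToContinuum.FouriersLaw.Cruxes.SuperadditiveResistance.CruxPosition

end
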